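import Summits.BirchSwinnertonDyer.Rank1Residual.Additive.SignedTwistKummerGroupPadic
import Summits.BirchSwinnertonDyer.Rank1Residual.Additive.GaloisCohomologyTorsionLevelBound
import Literature.NumberTheory.EllipticCurves.LocalEulerCharacteristicTorsion
import HarnessLib

/-!
# `#H¹(ℚ_p, W[p^m])[p] ≤ p²` from Tate's local Euler–Poincaré characteristic, and B3 in level-`m`
# shape for the signed twist modulo ONLY the named fact `localEulerPoincareCharacteristic ℚ_[p]`
# (cell `b2b-bsdres`, CLASS-CLOSURE lane, class O10 — x1b GEN 41, class lead; file 98 of the series)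

HONEST FRAMING (cell `b2b-bsdres`, run/shared/lean/b2b/bsd-rank1-residual/, verbatim in every
file): the goal of the cell is to DELETE the COMBINATION-SHAPED residual classes of the
Birch–Swinnerton-Dyer formula for ALL analytic-rank `≤ 1` elliptic curves over `ℚ` — "full BSD
formula for every rank `≤ 1` curve in class `C`" assembled STRICTLY from published theorems — so
that the rank-`≤ 1` remainder becomes exactly the CONSTRUCTION-SHAPED classes, which are TYPED
(missing-input `Prop`s), NOT attempted. This is not "finishing BSD". CLASS-CLOSURE lane: prove
what is provable now; shrink each hard class to its core with data; no claim beyond stated classes;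
research routes on CONSTRUCTION-SHAPED X12 / O10; census / instrument output = EVIDENCE / conjecture
items, NEVER a Literature fact; `RESIDUAL-MAP.md` marks change only by signed lines. THIS FILE:
TOOL THEOREMS ONLY — no definition, no named Literature fact, no `sorry`, axioms standard; nothing
is booked; no label / mark / count / sub-cell moves; (C1_η), (C2_η-GZ), (C3_η) stay typed as filed
(cc-typer-6's pen); nothing about `BSD(W, p)` of any pair is claimed. The ONE arithmetic input is
the tree's NAMED FACT `Literature.NumberTheory.GaloisRepresentations.localEulerPoincareCharacteristic`
(Milne, *ADT*, I Thm. 2.8), taken as a hypothesis `hEP` at `F = ℚ_[p]` — exactly as the count (C)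
(files 69/77/78) consumes it at the completions `ℚ_v`; the results below are CONDITIONAL on it.

## What

File 96 (`SignedTwist.closure_minus_sup_range_localKummerMap_eq_top_cyclotomic`) left B3 in
level-`m` shape for the `p*`-twist modulo ONE numerical hypothesis
`hHp : #H¹(ℚ_p, W[p^m])[p] ≤ p²`. This file DERIVES `hHp` from the named fact (the level
reduction `#H¹(E, E[p^{j+1}])[p] ≤ #H¹(E, E[p])` being file 97, `GaloisCohomologyTorsionLevelBound`):

* §2 (the model `ℚ_[p]`): `#(𝒪[ℚ_[p]] ⧸ p^k) = p^k` (`𝒪[ℚ_[p]] ≃+* ℤ_[p]`, tree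
  `Padic.nonempty_valuationInteger_ringEquiv_padicInt`); from `hEP`:
  **`#H¹(ℚ_p, W[p^k]) = (#W(ℚ_p)[p^k] · p^k)²`** (`natCard_galoisCohomology_torsion_padic_eq_sq`,
  Milne I Thm. 2.8 for `M = E[p^k]` with `#H⁰ = #H² = #W(ℚ_p)[p^k]` by the tree's
  `natCard_invariants_torsion_restrictField` / `natCard_galoisCohomology_two_torsion_restrictField`
  and the discharged local-field structure of `ℚ_[p]`, `Padic.isNonarchimedeanLocalField_holds`);
  with `W(ℚ_p)[p] = 0`: `#H¹(ℚ_p, W[p^k]) = p^{2k}` and **`#H¹(ℚ_p, W[p^m])[p] ≤ p²`**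
  (`natCard_ker_nsmul_galoisCohomology_padic_le_sq`).
* §3 **`closure_minus_sup_range_localKummerMap_eq_top_of_localEuler`**: file 96's theorem with
  `hHp` DISCHARGED — B3 in level-`m` shape for the `p*`-twist in Kobayashi's setting
  (`Σ ⊔ 𝓚 = H¹(ℚ_p, W[p^m])`, `#Σ = p^m`, `#H¹ = p^{2m}`, `Σ` cyclic) modulo ONLY the named fact
  `localEulerPoincareCharacteristic ℚ_[p]` (+ the `p`-integrality instance of `W`'s equation).

References: [MilneADT2006] Ch. I §2 Thm. 2.8 (p. 31), Cor. 2.3, §3 Lemma 3.3;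
[SerreGaloisCohomology1997] I §2.2, II §5.2 Prop. 14; [SilvermanAEC2009] III.6.4, VIII.§2;
[Kobayashi2003] Thm. 6.2 (p. 11).
-/

noncomputable section

open scoped Classical

open WeierstrassCurve Field

namespace Summit.BirchSwinnertonDyer.Rank1Residual.Additive.SignedTwist

open Literature.NumberTheory.EllipticCurves Literature.NumberTheory.GaloisRepresentations
  Literature.NumberTheory.EllipticCurves.Kobayashi2003 Literature.NumberTheory.EllipticCurves.ZpDescent
  Summit.BirchSwinnertonDyer.Rank1Residual.AdditivePotMult
  Summit.BirchSwinnertonDyer.Rank1Residual.Additive.PadicCyclotomicTower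
  ZpExtension
open scoped ContRepresentation

/-! ## §2 The model `ℚ_[p]`: `#(𝒪/p^k) = p^k`, the Euler count, `#H¹(ℚ_p, W[p^m])[p] ≤ p²` -/

section Padic

open scoped ValuativeRel

variable (W : WeierstrassCurve ℚ) [W.IsElliptic] {p : ℕ} [hp : Fact p.Prime]

omit [W.IsElliptic] in
/-- **`#(𝒪[ℚ_[p]] ⧸ p^k) = p^k`** for the valuation ring of Mathlib's valuative structure on `ℚ_[p]`
(`𝒪[ℚ_[p]] ≃+* ℤ_[p]`, tree `Padic.nonempty_valuationInteger_ringEquiv_padicInt`, and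
`ℤ_[p]/p^k ≅ ℤ/p^k`, Mathlib `PadicInt.ker_toZModPow`). [folklore] -/
theorem natCard_valuationInteger_padic_quotient_pow (k : ℕ) :
    Nat.card (𝒪[ℚ_[p]] ⧸ Ideal.span {((p ^ k : ℕ) : 𝒪[ℚ_[p]])}) = p ^ k := by
  obtain ⟨e⟩ := Padic.nonempty_valuationInteger_ringEquiv_padicInt p
  have hIJ : Ideal.span {((p ^ k : ℕ) : ℤ_[p])} =
      (Ideal.span {((p ^ k : ℕ) : 𝒪[ℚ_[p]])}).map (e : 𝒪[ℚ_[p]] →+* ℤ_[p]) := by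
    rw [Ideal.map_span, Set.image_singleton, map_natCast]
  rw [Nat.card_congr (Ideal.quotientEquiv _ _ e hIJ).toEquiv, Nat.cast_pow,
    ← PadicInt.ker_toZModPow,
    Nat.card_congr (RingHom.quotientKerEquivOfSurjective
      (ZMod.ringHom_surjective (PadicInt.toZModPow k))).toEquiv, Nat.card_zmod]

/-- **`#H¹(ℚ_p, W[p^k]) = (#W(ℚ_p)[p^k] · p^k)²`** (`k ≥ 1`) from Tate's local Euler–Poincaré
characteristic at `F = ℚ_[p]` (the named fact `localEulerPoincareCharacteristic ℚ_[p]`, Milne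
*ADT* I Thm. 2.8, for `M = E[p^k]`: `#M = p^{2k}`, `#H⁰ = #H² = #W(ℚ_p)[p^k]` by the tree's
`natCard_invariants_torsion_restrictField`, `natCard_galoisCohomology_two_torsion_restrictField`
(local duality in bidegree `(2,0)` + the Weil pairing), over the discharged local-field structure
`Padic.isNonarchimedeanLocalField_holds`). CONDITIONAL on the named fact.
[cite: MilneADT2006, Ch. I §2, Thm. 2.8 (p. 31) and Cor. 2.3; §3 Lemma 3.3]
[cite: SilvermanAEC2009, Cor. III.6.4 and Prop. III.8.1] -/
theorem natCard_galoisCohomology_torsion_padic_eq_sq {k : ℕ} (hk : 1 ≤ k)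
    (hEP : haveI : IsNonarchimedeanLocalField ℚ_[p] := Padic.isNonarchimedeanLocalField_holds p
      localEulerPoincareCharacteristic ℚ_[p]) :
    Nat.card (galoisCohomology
        (GaloisRep.restrictField ℚ_[p] (W.torsionGaloisModule ((p ^ k : ℕ) : ℤ))) 1) =
      (Nat.card (nsmulAddMonoidHom (p ^ k) : (W.baseChange ℚ_[p]).toAffine.Point →+ _).ker *
        p ^ k) ^ 2 := by
  haveI : IsNonarchimedeanLocalField ℚ_[p] := Padic.isNonarchimedeanLocalField_holds p
  haveI : NeZero (p ^ k) := ⟨pow_ne_zero k hp.out.ne_zero⟩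
  haveI : Finite (geomTorsion W ((p ^ k : ℕ) : ℤ)) := finite_geomTorsion_of_neZero W (p ^ k)
  have hn : IsPrimePow (p ^ k) := (isPrimePow_nat_iff (p ^ k)).mpr ⟨p, k, hp.out, hk, rfl⟩
  set ρ : ContinuousRep (absoluteGaloisGroup ℚ_[p]) ℤ (geomTorsion W ((p ^ k : ℕ) : ℤ)) :=
    GaloisRep.restrictField ℚ_[p] (W.torsionGaloisModule ((p ^ k : ℕ) : ℤ)) with hρ
  obtain ⟨-, -, hEq⟩ := hEP ρ
  -- `#E[p^k] = p^k · p^k`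
  have hMn : Nat.card (geomTorsion W ((p ^ k : ℕ) : ℤ)) = p ^ k * p ^ k := by
    rw [W.natCard_geomTorsion ((p ^ k : ℕ) : ℤ) (by exact_mod_cast NeZero.ne (p ^ k)),
      Int.natAbs_natCast, sq]
  have h0 : Nat.card ρ.toTopRep.ρ.invariants =
      Nat.card (nsmulAddMonoidHom (p ^ k) : (W.baseChange ℚ_[p]).toAffine.Point →+ _).ker :=
    natCard_invariants_torsion_restrictField W ℚ_[p] (NeZero.ne (p ^ k))
  have h2 : Nat.card (continuousCohomology 2 ρ.toTopRep) =
      Nat.card (nsmulAddMonoidHom (p ^ k) : (W.baseChange ℚ_[p]).toAffine.Point →+ _).ker :=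
    (natCard_galoisCohomology_two_torsion_restrictField W ℚ_[p] (p ^ k) hn).2
  have hq : Nat.card (𝒪[ℚ_[p]] ⧸
      Ideal.span {((Nat.card (geomTorsion W ((p ^ k : ℕ) : ℤ)) : ℕ) : 𝒪[ℚ_[p]])}) = (p ^ k) ^ 2 := by
    rw [hMn, ← pow_two, ← pow_mul, natCard_valuationInteger_padic_quotient_pow, pow_mul]
  change _ = Nat.card (continuousCohomology 1 ρ.toTopRep) at hEq
  change Nat.card (continuousCohomology 1 ρ.toTopRep) = _
  rw [← hEq, h0, h2, hq]
  ring

omit [W.IsElliptic] in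
/-- No `p`-torsion in `W(ℚ_p)` ⟹ `#W(ℚ_p)[p^k] = 1`. [folklore] -/
theorem natCard_ker_nsmul_pow_point_eq_one
    (htors : ∀ X : (W.baseChange ℚ_[p]).toAffine.Point, p • X = 0 → X = 0) (k : ℕ) :
    Nat.card (nsmulAddMonoidHom (p ^ k) : (W.baseChange ℚ_[p]).toAffine.Point →+ _).ker = 1 := by
  have h : (nsmulAddMonoidHom (p ^ k) : (W.baseChange ℚ_[p]).toAffine.Point →+ _).ker = ⊥ := by
    rw [eq_bot_iff]
    intro X hX
    rw [AddMonoidHom.mem_ker, nsmulAddMonoidHom_apply] at hX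
    rw [AddSubgroup.mem_bot]
    induction k with
    | zero => rwa [pow_zero, one_smul] at hX
    | succ k ih => exact ih (htors _ (by rwa [pow_succ, mul_comm, mul_smul] at hX))
  rw [h, AddSubgroup.card_bot]

/-- With `W(ℚ_p)[p] = 0`: **`#H¹(ℚ_p, W[p^k]) = p^{2k}`** (`k ≥ 1`), from the named fact.
[cite: MilneADT2006, Ch. I §2, Thm. 2.8 (p. 31)] -/
theorem natCard_galoisCohomology_torsion_padic_eq_pow {k : ℕ} (hk : 1 ≤ k)
    (hEP : haveI : IsNonarchimedeanLocalField ℚ_[p] := Padic.isNonarchimedeanLocalField_holds p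
      localEulerPoincareCharacteristic ℚ_[p])
    (htors : ∀ X : (W.baseChange ℚ_[p]).toAffine.Point, p • X = 0 → X = 0) :
    Nat.card (galoisCohomology
        (GaloisRep.restrictField ℚ_[p] (W.torsionGaloisModule ((p ^ k : ℕ) : ℤ))) 1) = p ^ (2 * k) := by
  rw [natCard_galoisCohomology_torsion_padic_eq_sq W hk hEP, natCard_ker_nsmul_pow_point_eq_one W htors,
    one_mul, ← pow_mul, mul_comm]

/-- With `W(ℚ_p)[p] = 0`: `E[p](ℚ̄)^{Γ_{ℚ_p}} = 0` (`#H⁰(ℚ_p, W[p]) = #W(ℚ_p)[p] = 1`, tree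
`natCard_invariants_torsion_restrictField`). [cite: MilneADT2006, Ch. I §3, Lemma 3.3] -/
theorem forall_mem_invariants_torsion_padic_eq_zero
    (htors : ∀ X : (W.baseChange ℚ_[p]).toAffine.Point, p • X = 0 → X = 0) :
    ∀ P ∈ (GaloisRep.restrictField ℚ_[p] (W.torsionGaloisModule ((p ^ 1 : ℕ) : ℤ))).toTopRep.ρ.invariants,
      P = 0 := by
  haveI : NeZero (p ^ 1) := ⟨pow_ne_zero 1 hp.out.ne_zero⟩
  haveI : Finite (geomTorsion W ((p ^ 1 : ℕ) : ℤ)) := finite_geomTorsion_of_neZero W (p ^ 1)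
  have hcard : Nat.card
      (GaloisRep.restrictField ℚ_[p] (W.torsionGaloisModule ((p ^ 1 : ℕ) : ℤ))).toTopRep.ρ.invariants = 1 := by
    rw [natCard_invariants_torsion_restrictField W ℚ_[p] (NeZero.ne (p ^ 1)),
      natCard_ker_nsmul_pow_point_eq_one W htors 1]
  obtain ⟨x, hx⟩ := Nat.card_eq_one_iff_exists.mp hcard
  intro P hP
  have h1 := hx ⟨P, hP⟩
  have h2 := hx ⟨0, Submodule.zero_mem _⟩
  exact congrArg Subtype.val (h1.trans h2.symm)

/-- **`#H¹(ℚ_p, W[p^m])[p] ≤ p²`** for `W/ℚ` elliptic with `W(ℚ_p)[p] = 0`, from the named fact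
`localEulerPoincareCharacteristic ℚ_[p]`: for `m = j + 1` by §1 (`#H¹[p] ≤ #H¹(ℚ_p, W[p]) = p²`);
for `m = 0` the group `H¹(ℚ_p, W[1])` is trivial. This is the hypothesis `hHp` of files 94–96.
[cite: MilneADT2006, Ch. I §2, Thm. 2.8 (p. 31)] [cite: SerreGaloisCohomology1997, I §2.2] -/
theorem natCard_ker_nsmul_galoisCohomology_padic_le_sq (m : ℕ)
    (hEP : haveI : IsNonarchimedeanLocalField ℚ_[p] := Padic.isNonarchimedeanLocalField_holds p
      localEulerPoincareCharacteristic ℚ_[p])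
    (htors : ∀ X : (W.baseChange ℚ_[p]).toAffine.Point, p • X = 0 → X = 0) :
    Nat.card (nsmulAddMonoidHom p : galoisCohomology
        (GaloisRep.restrictField ℚ_[p] (W.torsionGaloisModule ((p ^ m : ℕ) : ℤ))) 1 →+ _).ker ≤ p ^ 2 := by
  haveI hfin : ∀ n : ℕ, Finite (galoisCohomology
      (GaloisRep.restrictField ℚ_[p] (W.torsionGaloisModule ((p ^ n : ℕ) : ℤ))) 1) := fun n =>
    finite_galoisCohomology_torsion_padic W (by exact_mod_cast pow_ne_zero n hp.out.ne_zero)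
  cases m with
  | zero =>
    -- `H¹(ℚ_p, W[1]) = 0`
    have hcard : Nat.card (galoisCohomology
        (GaloisRep.restrictField ℚ_[p] (W.torsionGaloisModule ((p ^ 0 : ℕ) : ℤ))) 1) = 1 := by
      refine Nat.card_eq_one_iff_exists.mpr ⟨0, fun h => ?_⟩
      have h1 := pow_smul_galoisCohomology_torsion_eq_zero W 0 ℚ_[p] h
      change 1 • h = 0 at h1
      rwa [one_smul] at h1
    calc _ ≤ Nat.card (galoisCohomology
          (GaloisRep.restrictField ℚ_[p] (W.torsionGaloisModule ((p ^ 0 : ℕ) : ℤ))) 1) :=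
          AddSubgroup.card_le_card_addGroup _
      _ = 1 := hcard
      _ ≤ p ^ 2 := Nat.one_le_pow _ _ hp.out.pos
  | succ j =>
    calc _ ≤ Nat.card (galoisCohomology
          (GaloisRep.restrictField ℚ_[p] (W.torsionGaloisModule ((p ^ 1 : ℕ) : ℤ))) 1) :=
          natCard_ker_nsmul_galoisCohomology_le W ℚ_[p] p j
            (forall_mem_invariants_torsion_padic_eq_zero W htors)
      _ = p ^ 2 := by
          rw [natCard_galoisCohomology_torsion_padic_eq_pow W le_rfl hEP htors, mul_one]

end Padic

/-! ## §3 B3 in level-`m` shape modulo the named fact only -/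

section Cyclotomic

variable (W : WeierstrassCurve ℚ) [W.IsElliptic] {p : ℕ} [hp : Fact p.Prime] (κ : ZpExtension ℚ p)
  {V : WeierstrassCurve ℚ} [V.IsElliptic]
  (F : Type) [Field F] [NumberField F] [IsCyclotomicExtension {p} ℚ F]
  [hint : (W.baseChange ℚ_[p]).IsIntegral ℤ_[p]]

include F in
/-- **B3 IN LEVEL-`m` SHAPE FOR THE `p*`-TWIST, modulo ONLY the named fact
`localEulerPoincareCharacteristic ℚ_[p]`** (Kobayashi's setting: `F = ℚ(μ_p)`, `κ` cyclotomic,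
`V = C • W^{(p*)}` with a good supersingular `a_p = 0` model `M` over `ℤ_p`, `p` odd, `W`'s
equation `p`-integral, `2m ≤ n + 1`): with `Σ = closure{minus classes}` (classes of
`H¹(ℚ_p, W[p^m])` restricting on `Gal(ℚ̄_p/ℚ_n·ℚ_p)` to Kummer cocycles of `p^m`-th roots of
zero-clause minus points of `W(ℚ_n·ℚ_p)`) and `𝓚 = range (localKummerMap)` the Kummer group of
`W(ℚ_p)`: **`Σ ⊔ 𝓚 = H¹(ℚ_p, W[p^m])`, `#Σ = p^m`, `#H¹ = p^{2m}`, and `Σ` has an element of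
order `p^m`.** File 96 with its hypothesis `#H¹(ℚ_p, W[p^m])[p] ≤ p²` DISCHARGED by §2
(`W(ℚ_p)[p] = 0` for the `p*`-twist: `eq_zero_of_prime_smul_eq_zero_padic_of_quadraticTwist_signedPrime`).
CONDITIONAL on the named fact (Milne *ADT* I Thm. 2.8); nothing booked.
[cite: Kobayashi2003, §3 p. 5, Thm. 6.2 (p. 11), Prop. 8.7 (p. 16), Prop. 8.12 (p. 17), Lemma 8.17 (p. 19)]
[cite: MilneADT2006, Ch. I §2, Thm. 2.8 (p. 31)] [cite: SilvermanAEC2009, IV.6.4, VII.6.3, VIII.§2] -/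
theorem closure_minus_sup_range_localKummerMap_eq_top_of_localEuler (hp2 : p ≠ 2) (hκ : κ.IsCyclotomic)
    (C : VariableChange ℚ) (hCV : C • W.quadraticTwist ((-1) ^ (p / 2) * p) = V)
    (M : WeierstrassCurve ℤ_[p]) [hE : (M.map PadicInt.Coe.ringHom).IsElliptic]
    [hEt : (M.map PadicInt.toZMod).IsElliptic]
    (htr : Literature.NumberTheory.EllipticCurves.HasseManin.tr (M.map PadicInt.toZMod) = 0)
    (hVM : M.baseChange (AlgebraicClosure ℚ_[p]) = V.baseChange (AlgebraicClosure ℚ_[p]))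
    {n m : ℕ} (hnm : 2 * m ≤ n + 1)
    (hEP : haveI : IsNonarchimedeanLocalField ℚ_[p] := Padic.isNonarchimedeanLocalField_holds p
      localEulerPoincareCharacteristic ℚ_[p]) :
    AddSubgroup.closure {ξ | ∃ x ∈ signedLocalPointsOfEmb κ (closureEmb (K := ℚ) ℚ_[p]) W (-1) n ⊓
          (localTraceOfEmb κ (closureEmb (K := ℚ) ℚ_[p]) W 0 n).ker,
        ∃ R : localPoints W ℚ_[p], ((p ^ m : ℕ) : ℤ) • R = x ∧
        ∃ φ : contOneCocycles (DiscreteGaloisModule.toTopRep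
            (GaloisRep.restrictField ℚ_[p] (W.torsionGaloisModule ((p ^ m : ℕ) : ℤ)))),
          oneCocycleClass _ φ = ξ ∧
          ∀ u ∈ localLayerSubgroupOfEmb κ (closureEmb (K := ℚ) ℚ_[p]) n,
            pointsMap W ℚ_[p] ((φ.1 u : geomTorsion W ((p ^ m : ℕ) : ℤ)) : geomPoints W) = u • R - R} ⊔
        (W.localKummerMap ℚ_[p]
          (show (((p ^ m : ℕ) : ℤ)) ≠ 0 by exact_mod_cast pow_ne_zero m hp.out.ne_zero)).range = ⊤ ∧
      Nat.card (AddSubgroup.closure {ξ | ∃ x ∈ signedLocalPointsOfEmb κ (closureEmb (K := ℚ) ℚ_[p]) W (-1) n ⊓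
          (localTraceOfEmb κ (closureEmb (K := ℚ) ℚ_[p]) W 0 n).ker,
        ∃ R : localPoints W ℚ_[p], ((p ^ m : ℕ) : ℤ) • R = x ∧
        ∃ φ : contOneCocycles (DiscreteGaloisModule.toTopRep
            (GaloisRep.restrictField ℚ_[p] (W.torsionGaloisModule ((p ^ m : ℕ) : ℤ)))),
          oneCocycleClass _ φ = ξ ∧
          ∀ u ∈ localLayerSubgroupOfEmb κ (closureEmb (K := ℚ) ℚ_[p]) n,
            pointsMap W ℚ_[p] ((φ.1 u : geomTorsion W ((p ^ m : ℕ) : ℤ)) : geomPoints W) = u • R - R}) =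
        p ^ m ∧
      Nat.card (galoisCohomology (GaloisRep.restrictField ℚ_[p] (W.torsionGaloisModule ((p ^ m : ℕ) : ℤ))) 1) =
        p ^ (2 * m) ∧
      ∃ s ∈ AddSubgroup.closure {ξ | ∃ x ∈ signedLocalPointsOfEmb κ (closureEmb (K := ℚ) ℚ_[p]) W (-1) n ⊓
          (localTraceOfEmb κ (closureEmb (K := ℚ) ℚ_[p]) W 0 n).ker,
        ∃ R : localPoints W ℚ_[p], ((p ^ m : ℕ) : ℤ) • R = x ∧
        ∃ φ : contOneCocycles (DiscreteGaloisModule.toTopRep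
            (GaloisRep.restrictField ℚ_[p] (W.torsionGaloisModule ((p ^ m : ℕ) : ℤ)))),
          oneCocycleClass _ φ = ξ ∧
          ∀ u ∈ localLayerSubgroupOfEmb κ (closureEmb (K := ℚ) ℚ_[p]) n,
            pointsMap W ℚ_[p] ((φ.1 u : geomTorsion W ((p ^ m : ℕ) : ℤ)) : geomPoints W) = u • R - R},
        addOrderOf s = p ^ m := by
  obtain ⟨M', hΔ, hA, hVM'⟩ :
      ∃ M' : WeierstrassCurve ℤ_[p], IsUnit M'.Δ ∧ M'.hasseCoeff p ∈ IsLocalRing.maximalIdeal ℤ_[p] ∧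
        M'.baseChange (AlgebraicClosure ℚ_[p]) = V.baseChange (AlgebraicClosure ℚ_[p]) :=
    ⟨M, isUnit_Δ_of_isElliptic_toZMod p M, hasseCoeff_mem_maximalIdeal_of_tr_eq_zero hp2 M htr, hVM⟩
  have htorsX := eq_zero_of_prime_smul_eq_zero_padic_of_quadraticTwist_signedPrime hp2 W C hCV M' hΔ hA hVM'
  exact closure_minus_sup_range_localKummerMap_eq_top_cyclotomic W κ F hp2 hκ C hCV M htr hVM hnm
    (natCard_ker_nsmul_galoisCohomology_padic_le_sq W m hEP htorsX)

end Cyclotomic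


end Summit.BirchSwinnertonDyer.Rank1Residual.Additive.SignedTwist

end
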